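import Summits.Schanuel.Schanuel.Theorems.RootDecomp1BTwoRadical05

/-!
# RootDecomp1BAlgLiouvilleColumn — lens 4, generation 44, node 3 (g44c) «THE ALGEBRAIC–LIOUVILLE COLUMN, UNCOUPLED» — OF-RECORD, ×0 (CLAIM L2280 + correction L2286; critic ACK L2287: EX-ANTE PRICE ×0 = VARIANT of record of g44b's kernel, no NODE; OF-RECORD files published L2291, verified by the critic L2293; PORT at census's discretion, critic's recommendation YES «already farm-clean and strictly enlarges the tree's reached set») — continuation (RootDecomp1BAlgLiouvilleColumn01): §H3.1–H3.3

(lens-4 g44c HOME file K3 = HOME/decomp-schanuel-lens-4/g44c/AlgLiouvilleColumn.lean de6287cc…, 1748 l = g44b TwoRadical.lean b925f14a… l.13–1326 VERBATIM (tree: RootDecomp1BTwoRadical01–05) + §H3 (l.1338–1747, namespace `…RootDecomp1BAlgLiouvilleColumn`). Port by census-1 gen 19 of §H3 ONLY, as `RootDecomp1BAlgLiouvilleColumn01` (H3.1 counting along a selection of indices, H3.2 the two frame engines `engine_in` / `engine_out` — kernel `RootDecomp1BTwoRadical.algebraicIndependent_twoRadical` BY NAME —, H3.3 integer relations `exists_nat_eq_intCombination`,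 the exchange lemma `linearIndependent_update_of_intRel`) and `RootDecomp1BAlgLiouvilleColumn02` (H3.4 the uncoupled column `polarDeg_snoc_algebraic_ultra_of_LW` / `polarDeg_snoc_algebraic_ultra {β : Fin m → ℝ} (hβ : ∀ j, IsAlgebraic ℚ (β j)) (hli : LinearIndependent ℚ β) (hρ : UltraLiouville ρ) : ((m + 1 + (m + 1) + 1 : ℕ) : Cardinal) ≤ polarDeg (Fin.snoc β ρ)` HYP-FREE via `lwMeasure_holds`, H3.5 cells `five_le_polarDeg_sqrt_two_ultra`, `four_le_…`, `five_le_polarDeg_sqrt_two_rhoU`, `three_le_polarDeg_ultra`, `three_le_polarDeg_rhoU`, `four_le_trdeg_polar_sqrt_two_ultra`), importing tree `…RootDecomp1BTwoRadical05`; file names follow the namespace (the critic's «TwoRadical06(–07)» numbering is the same two files).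
PORT EDITS: linter option dropped; five generic helpers private (`isAlgebraic_sqrt_two`, `linearIndependent_sqrt_two`, `snoc_sqrt_two_eq`, `snoc_elim0_eq`, `card_le_trdeg_of_algebraicIndependent` — dedup-safety) with per-part private copies; four one-line docstrings added; statements and proofs verbatim. `--supports stmt-Schanuel-24622`; no credit of any kind (×0 of record); rung 0 — nothing here proves Schanuel.)
-/

noncomputable section

open Complex

namespace Summit.Schanuel.Schanuel.Theorems.RootDecomp1BAlgLiouvilleColumn

open Summit.Schanuel.Schanuel.Theorems.RootDecomp1KHyper (LWMeasure)
open Summit.Schanuel.Schanuel.Theorems.RootDecomp1BFedFlagCore (polarDeg polarField coe_mem_polarField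
  exp_coe_mem_polarField exp_coe_mul_I_mem_polarField coe_mul_I_mem_polarField)
open Summit.Schanuel.Schanuel.Theorems.RootDecomp1BDefectFloorCells (natCast_le_trdeg_of_algebraicIndependent
  isAlgebraic_polarExp linearIndependent_polar)
open Summit.Schanuel.Schanuel.Theorems.RootDecomp1BRadicalDescent (DExpMeasure dExpMeasure_exp_of_LW UltraLiouville
  rhoU ultraLiouville_rhoU)
open Summit.Schanuel.Schanuel.Theorems.RootDecomp1BFactDischarge (lwMeasure_holds)
open Summit.Schanuel.Schanuel.Theorems.RootDecomp1BTwoRadical (algebraicIndependent_twoRadical)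

/-! ## §H3 THE ALGEBRAIC–LIOUVILLE COLUMN, UNCOUPLED (lens-4, generation 44, node 3 = g44c; CLAIM bus L2280)

`t(β | ρ) ≥ (m+1) + (m+1) + 1` for EVERY `ℚ`-free real algebraic tuple `β : Fin m → ℝ` and EVERY ultra-Liouville `ρ`,
HYPOTHESIS-FREE — the item-24622 instance (value `(m+1)+(m+1)`) with surplus one at the column `(β | ρ)` with NO coupling
between `β` and `ρ` (the tree's `RootDecomp1BRadicalDescent.polarDeg_snoc_ultra` and §G2 need the last coordinate to be
`β_{j₀}·ρ`).  Kernel = `algebraicIndependent_twoRadical` BY NAME; the two new devices are bookkeeping: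
(a) OUTSIDE-BASE RESTRICTION (`engine_out`, case `1 ∉ span_ℚ β`): the L–W base `exp(polar(γ₀ | γ))` may have its two
    `γ₀`-members OUTSIDE the field; algebraic independence restricts to the `2k+3` members inside
    (`card_le_trdeg_of_algebraicIndependent`, a `Finset`-indexed form of the tree's counting lemma);
(b) INTEGER-RELATION EXCHANGE (case `1 ∈ span_ℚ β`): clear denominators in `1 = Σ c_j β_j` to `N = Σ n_j β_j`
    (`exists_nat_eq_intCombination`), exchange `β_{j₁} ↦ N` in the base (`linearIndependent_update_of_intRel`), so that
    `e^N = Π (e^{β_j})^{n_j}` and the moving pair `(e^σ)^N, (e^{iσ})^N` all lie inside the field (`engine_in`). -/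

/-! ### H3.1 Counting along a selection of indices -/

/-- The tree's counting lemma `natCast_le_trdeg_of_algebraicIndependent` along a `Finset` of indices: if `z` is
algebraically independent and the members `z i`, `i ∈ s`, lie in `L`, then `#s ≤ trdeg L`. -/
private theorem card_le_trdeg_of_algebraicIndependent {K : ℕ} {L : IntermediateField ℚ ℂ} {z : Fin K → ℂ}
    (hz : AlgebraicIndependent ℚ z) (s : Finset (Fin K)) (hmem : ∀ i ∈ s, z i ∈ L) :
    (s.card : Cardinal) ≤ Algebra.trdeg ℚ ↥L := by
  refine natCast_le_trdeg_of_algebraicIndependent (z := fun i => z ((s.equivFin.symm i : s) : Fin K)) ?_ ?_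
  · exact hz.comp _ (Subtype.val_injective.comp s.equivFin.symm.injective)
  · intro i
    exact hmem _ (s.equivFin.symm i).2

/-! ### H3.2 The two frame engines (kernel `algebraicIndependent_twoRadical` by name) -/

/-- ENGINE (all inside): base logs `γ` real algebraic `ℚ`-free with ALL base exponentials in `L`, moving pair at
`γ_{j₀}`, parameter `σ > 0` ultra-Liouville in `L`: `2k + 3 ≤ trdeg L`. -/
theorem engine_in (hLW : LWMeasure) {k : ℕ} {γ : Fin k → ℝ}
    (hγ : ∀ j, IsAlgebraic ℚ ((γ j : ℝ) : ℂ)) (hli : LinearIndependent ℚ γ) (j₀ : Fin k) {σ : ℝ}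
    (hσ : UltraLiouville σ) (hσ0 : 0 < σ) {L : IntermediateField ℚ ℂ}
    (heσ : cexp ((σ : ℂ) * ((γ j₀ : ℝ) : ℂ)) ∈ L)
    (heσi : cexp ((σ : ℂ) * (((γ j₀ : ℝ) : ℂ) * Complex.I)) ∈ L) (hσm : (σ : ℂ) ∈ L)
    (hmem : ∀ j, cexp ((γ j : ℝ) : ℂ) ∈ L) (hmemi : ∀ j, cexp (((γ j : ℝ) : ℂ) * Complex.I) ∈ L) :
    ((k + k + 3 : ℕ) : Cardinal) ≤ Algebra.trdeg ℚ ↥L := by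
  obtain ⟨y, hy⟩ : ∃ y : Fin (k + k) → ℂ,
      y = Fin.append (fun j => ((γ j : ℝ) : ℂ)) (fun j => ((γ j : ℝ) : ℂ) * Complex.I) := ⟨_, rfl⟩
  have hθ : DExpMeasure (fun i => cexp (y i)) :=
    dExpMeasure_exp_of_LW hLW (fun i => by rw [hy]; exact isAlgebraic_polarExp γ hγ i)
      (by rw [hy]; exact linearIndependent_polar hli)
  have hy0 : cexp ((γ j₀ : ℝ) : ℂ) = (fun i => cexp (y i)) (Fin.castAdd k j₀) := by
    show cexp _ = cexp (y (Fin.castAdd k j₀))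
    rw [hy, Fin.append_left]
  have hy1 : cexp (((γ j₀ : ℝ) : ℂ) * Complex.I) = (fun i => cexp (y i)) (Fin.natAdd k j₀) := by
    show cexp _ = cexp (y (Fin.natAdd k j₀))
    rw [hy, Fin.append_right]
  have hne : Fin.castAdd k j₀ ≠ Fin.natAdd k j₀ := by
    intro h
    have h' := congrArg Fin.val h
    simp only [Fin.val_castAdd, Fin.val_natAdd] at h'
    have := j₀.isLt
    omega
  have hθmem : ∀ i, (fun i => cexp (y i)) i ∈ L := by
    intro i
    show cexp (y i) ∈ _
    rw [hy]
    induction i using Fin.addCases with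
    | left j => rw [Fin.append_left]; exact hmem j
    | right j => rw [Fin.append_right]; exact hmemi j
  have hai := algebraicIndependent_twoRadical hθ hne hy0 hy1 hσ hσ0
  refine natCast_le_trdeg_of_algebraicIndependent hai fun i => ?_
  refine Fin.cases ?_ (fun i => ?_) i
  · simp only [Fin.cons_zero]
    exact heσ
  · rw [Fin.cons_succ]
    refine Fin.cases ?_ (fun i => ?_) i
    · simp only [Fin.cons_zero]
      exact heσi
    · rw [Fin.cons_succ]
      refine Fin.cases ?_ (fun j => ?_) i
      · simp only [Fin.cons_zero]
        exact hσm
      · rw [Fin.cons_succ]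
        exact hθmem j

/-- ENGINE (moving logs outside): base logs `(γ₀ | γ)` real algebraic `ℚ`-free, the base exponentials of `γ` in `L`
(those of `γ₀` NOT required in `L`), moving pair at `γ₀`, parameter `σ > 0` ultra-Liouville in `L`:
`2k + 3 ≤ trdeg L` — the kernel's `(2k+5)`-tuple restricted to its members inside `L`. -/
theorem engine_out (hLW : LWMeasure) {k : ℕ} {γ₀ : ℝ} {γ : Fin k → ℝ}
    (hγ₀ : IsAlgebraic ℚ ((γ₀ : ℝ) : ℂ)) (hγ : ∀ j, IsAlgebraic ℚ ((γ j : ℝ) : ℂ))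
    (hli : LinearIndependent ℚ (Fin.cons γ₀ γ : Fin (k + 1) → ℝ)) {σ : ℝ}
    (hσ : UltraLiouville σ) (hσ0 : 0 < σ) {L : IntermediateField ℚ ℂ}
    (heσ : cexp ((σ : ℂ) * ((γ₀ : ℝ) : ℂ)) ∈ L)
    (heσi : cexp ((σ : ℂ) * (((γ₀ : ℝ) : ℂ) * Complex.I)) ∈ L) (hσm : (σ : ℂ) ∈ L)
    (hmem : ∀ j, cexp ((γ j : ℝ) : ℂ) ∈ L) (hmemi : ∀ j, cexp (((γ j : ℝ) : ℂ) * Complex.I) ∈ L) :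
    ((k + k + 3 : ℕ) : Cardinal) ≤ Algebra.trdeg ℚ ↥L := by
  obtain ⟨δ, hδ⟩ : ∃ δ : Fin (k + 1) → ℝ, δ = Fin.cons γ₀ γ := ⟨_, rfl⟩
  have hδalg : ∀ j, IsAlgebraic ℚ ((δ j : ℝ) : ℂ) := by
    intro j
    rw [hδ]
    refine Fin.cases ?_ (fun j => ?_) j
    · simpa only [Fin.cons_zero] using hγ₀
    · simpa only [Fin.cons_succ] using hγ j
  have hδli : LinearIndependent ℚ δ := by rw [hδ]; exact hli
  obtain ⟨y, hy⟩ : ∃ y : Fin (k + 1 + (k + 1)) → ℂ,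
      y = Fin.append (fun j => ((δ j : ℝ) : ℂ)) (fun j => ((δ j : ℝ) : ℂ) * Complex.I) := ⟨_, rfl⟩
  have hθ : DExpMeasure (fun i => cexp (y i)) :=
    dExpMeasure_exp_of_LW hLW (fun i => by rw [hy]; exact isAlgebraic_polarExp δ hδalg i)
      (by rw [hy]; exact linearIndependent_polar hδli)
  have hδ0 : δ 0 = γ₀ := by rw [hδ]; exact Fin.cons_zero _ _
  have hy0 : cexp ((γ₀ : ℝ) : ℂ) = (fun i => cexp (y i)) (Fin.castAdd (k + 1) 0) := by
    show cexp _ = cexp (y (Fin.castAdd (k + 1) 0))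
    rw [hy, Fin.append_left, hδ0]
  have hy1 : cexp (((γ₀ : ℝ) : ℂ) * Complex.I) = (fun i => cexp (y i)) (Fin.natAdd (k + 1) 0) := by
    show cexp _ = cexp (y (Fin.natAdd (k + 1) 0))
    rw [hy, Fin.append_right, hδ0]
  have hne : Fin.castAdd (k + 1) (0 : Fin (k + 1)) ≠ Fin.natAdd (k + 1) 0 := by
    intro h
    have h' := congrArg Fin.val h
    simp only [Fin.val_castAdd, Fin.val_natAdd] at h'
    omega
  have hai := algebraicIndependent_twoRadical hθ hne hy0 hy1 hσ hσ0
  -- the two indices of the kernel tuple whose members may lie outside `L`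
  set a : Fin (k + 1 + (k + 1) + 3) := (Fin.castAdd (k + 1) (0 : Fin (k + 1))).succ.succ.succ with ha
  set b : Fin (k + 1 + (k + 1) + 3) := (Fin.natAdd (k + 1) (0 : Fin (k + 1))).succ.succ.succ with hb
  have hab : a ≠ b := by
    intro h
    rw [ha, hb] at h
    exact hne (Fin.succ_injective _ (Fin.succ_injective _ (Fin.succ_injective _ h)))
  have hcard : (Finset.univ \ {a, b} : Finset (Fin (k + 1 + (k + 1) + 3))).card = k + k + 3 := by
    rw [Finset.card_sdiff, Finset.inter_univ, Finset.card_univ, Fintype.card_fin, Finset.card_pair hab]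
    omega
  have key := card_le_trdeg_of_algebraicIndependent (L := L) hai (Finset.univ \ {a, b}) ?_
  · rwa [hcard] at key
  intro i hi
  simp only [Finset.mem_sdiff, Finset.mem_univ, true_and, Finset.mem_insert, Finset.mem_singleton, not_or] at hi
  obtain ⟨hia, hib⟩ := hi
  cases i using Fin.cases with
  | zero => simp only [Fin.cons_zero]; exact heσ
  | succ i =>
    rw [Fin.cons_succ]
    cases i using Fin.cases with
    | zero => simp only [Fin.cons_zero]; exact heσi
    | succ i =>
      rw [Fin.cons_succ]
      cases i using Fin.cases with
      | zero => simp only [Fin.cons_zero]; exact hσm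
      | succ j =>
        rw [Fin.cons_succ]
        show cexp (y j) ∈ L
        rw [hy]
        cases j using Fin.addCases with
        | left j =>
          rw [Fin.append_left]
          cases j using Fin.cases with
          | zero => exact absurd ha.symm hia
          | succ j =>
            have : δ j.succ = γ j := by rw [hδ]; exact Fin.cons_succ _ _ _
            rw [this]
            exact hmem j
        | right j =>
          rw [Fin.append_right]
          cases j using Fin.cases with
          | zero => exact absurd hb.symm hib
          | succ j =>
            have : δ j.succ = γ j := by rw [hδ]; exact Fin.cons_succ _ _ _
            rw [this]
            exact hmemi j

/-! ### H3.3 Integer relations: clearing denominators and the exchange lemma -/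

/-- Clearing denominators: a rational combination equal to `1` gives a positive INTEGER `N = Σ n_j β_j`, `n ∈ ℤ^m`. -/
theorem exists_nat_eq_intCombination {m : ℕ} {β : Fin m → ℝ} (c : Fin m → ℚ)
    (hc : ∑ j, (c j : ℝ) * β j = 1) :
    ∃ (N : ℕ) (n : Fin m → ℤ), 0 < N ∧ (N : ℝ) = ∑ j, (n j : ℝ) * β j := by
  set D : ℕ := ∏ j, (c j).den with hD
  have hDpos : 0 < D := Finset.prod_pos fun j _ => (c j).den_pos
  have hdvd : ∀ j, (c j).den ∣ D := fun j => Finset.dvd_prod_of_mem (fun j => (c j).den) (Finset.mem_univ j)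
  refine ⟨D, fun j => (c j).num * ((D / (c j).den : ℕ) : ℤ), hDpos, ?_⟩
  have hn : ∀ j, (((c j).num * ((D / (c j).den : ℕ) : ℤ) : ℤ) : ℝ) = (c j : ℝ) * D := by
    intro j
    obtain ⟨e, he⟩ := hdvd j
    have hden : ((c j).den : ℝ) ≠ 0 := Nat.cast_ne_zero.2 (c j).den_pos.ne'
    rw [he, Nat.mul_div_cancel_left _ (c j).den_pos]
    push_cast
    rw [Rat.cast_def]
    field_simp
  simp_rw [hn]
  calc (D : ℝ) = D * ∑ j, (c j : ℝ) * β j := by rw [hc, mul_one]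
    _ = ∑ j, (c j : ℝ) * D * β j := by rw [Finset.mul_sum]; refine Finset.sum_congr rfl fun j _ => by ring

/-- EXCHANGE: replacing `β_{j₁}` by an integer combination `N = Σ n_j β_j` with `n_{j₁} ≠ 0` keeps `ℚ`-freeness. -/
theorem linearIndependent_update_of_intRel {m : ℕ} {β : Fin m → ℝ} (hli : LinearIndependent ℚ β)
    (n : Fin m → ℤ) {N : ℝ} (hN : N = ∑ j, (n j : ℝ) * β j) {j₁ : Fin m} (hj₁ : n j₁ ≠ 0) :
    LinearIndependent ℚ (Function.update β j₁ N) := by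
  rw [Fintype.linearIndependent_iff] at hli ⊢
  intro g hg
  -- `hg : Σ g_k • (update β j₁ N) k = 0`; rewrite it as a rational relation among the `β_k`
  have hg' : (g j₁ : ℝ) * N + ∑ k ∈ Finset.univ.erase j₁, (g k : ℝ) * β k = 0 := by
    rw [← Finset.add_sum_erase _ _ (Finset.mem_univ j₁)] at hg
    simp only [Rat.smul_def, Function.update_self] at hg
    rw [Finset.sum_congr rfl (fun k hk => by rw [Function.update_of_ne (Finset.ne_of_mem_erase hk)])] at hg
    exact hg
  set G : Fin m → ℚ := fun k => (if k = j₁ then 0 else g k) + g j₁ * (n k : ℚ) with hG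
  have key : ∑ k, G k • β k = 0 := by
    have h1 : ∑ k, ((if k = j₁ then 0 else g k : ℚ) : ℝ) * β k =
        ∑ k ∈ Finset.univ.erase j₁, (g k : ℝ) * β k := by
      rw [← Finset.add_sum_erase _ _ (Finset.mem_univ j₁)]
      simp only [if_true, Rat.cast_zero, zero_mul, zero_add]
      exact Finset.sum_congr rfl fun k hk => by rw [if_neg (Finset.ne_of_mem_erase hk)]
    have h2 : ∑ k, ((g j₁ * (n k : ℚ) : ℚ) : ℝ) * β k = (g j₁ : ℝ) * N := by
      rw [hN, Finset.mul_sum]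
      refine Finset.sum_congr rfl fun k _ => ?_
      push_cast
      ring
    simp only [hG, Rat.smul_def, Rat.cast_add, add_mul, Finset.sum_add_distrib]
    rw [h1, h2, add_comm]
    exact hg'
  have hz := hli G key
  have hgj₁ : g j₁ = 0 := by
    have := hz j₁
    simp only [hG, if_true, zero_add, mul_eq_zero, Int.cast_eq_zero] at this
    exact this.resolve_right hj₁
  intro j
  by_cases hjj : j = j₁
  · rw [hjj]; exact hgj₁
  · have := hz j
    simp only [hG, if_neg hjj, hgj₁, zero_mul, add_zero] at this
    exact this

end Summit.Schanuel.Schanuel.Theorems.RootDecomp1BAlgLiouvilleColumn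

end
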